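import Mathlib
import Summits.Ventures.PercRepro2.Graph
import Summits.Ventures.PercRepro2.Exploration
import Summits.Ventures.PercRepro2.Harris
import Summits.Ventures.PercRepro2.GibbsPAJoint
import Summits.Ventures.PercRepro2.SepClusterJoint
import Summits.Ventures.PercRepro2.SepClusterSupport
import Summits.Ventures.PercRepro2.SepClusterHarris

/-!
# The separated clusters of a family of roots — the joint law (blind cell PercRepro2, p3 g12,
2026-08-27; `proofs/P3-G2.md` §2 for root SETS `X`, `Y`)

The multi-root form of `SepClusterJoint`: the explored object of a finite set of roots `Y` is
the TUPLE of their clusters `expl ends ω Y : Y → Set V` (ordered coordinatewise; `r ↔ s` is the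
coordinate statement `s ∈ (expl …) r`), its footprint `foot t = ⋃ y, t y`, the separation event
`sepFam ends X Y = {no root of X is joined to a root of Y}`, and the joint law
`Jf t k = P(expl Y = t, expl X = k, S) / P(S)`.  The domain-Markov identity `prob_joint_fam`
rests on `conn_restrict_iff_of_closed`: removing the edges touching a set closed under open
adjacency (a union of clusters) does not change the connections of the vertices outside it.
Own work; standard axioms.
-/

namespace Summit.Ventures.PercRepro2

namespace SepPA

open Finset Classical

section FamilySets

variable {V : Type*} {E : Type*}
variable (ends : E → Sym2 V)

/-- The tuple of clusters of the roots `Y`. -/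
def expl (ω : Config E) (Y : Finset V) : Y → Set V := fun y => cluster ends ω y

/-- The footprint of a tuple of sets. -/
def foot {Y : Finset V} (t : Y → Set V) : Set V := {v | ∃ y : Y, v ∈ t y}

/-- The family separation event: no root of `X` is joined to a root of `Y`. -/
def sepFam (X Y : Finset V) : Set (Config E) := {ω | ∀ x ∈ X, ∀ y ∈ Y, ¬ Conn ends ω x y}

/-- The event `{expl Y = t}`. -/
def explEvent (Y : Finset V) (t : Y → Set V) : Set (Config E) :=
  {ω | ∀ y : Y, cluster ends ω y = t y}

variable {ends}

/-- Membership in `explEvent`. -/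
lemma mem_explEvent {Y : Finset V} {t : Y → Set V} {ω : Config E} :
    ω ∈ explEvent ends Y t ↔ ∀ y : Y, cluster ends ω y = t y := Iff.rfl

/-- `explEvent Y t = {ω | expl ω Y = t}`. -/
lemma explEvent_eq_preimage (Y : Finset V) (t : Y → Set V) :
    explEvent ends Y t = {ω | expl ends ω Y = t} := by
  ext ω
  simp only [mem_explEvent, Set.mem_setOf_eq]
  constructor
  · intro h; funext y; exact h y
  · intro h y; exact congrFun h y

/-- Every root lies in its own coordinate of the tuple, hence in the footprint. -/
lemma mem_foot_of_mem_explEvent {Y : Finset V} {t : Y → Set V} {ω : Config E}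
    (hω : ω ∈ explEvent ends Y t) (y : Y) : (y : V) ∈ foot t :=
  ⟨y, by rw [← hω y]; exact mem_cluster_self ends ω y⟩

/-- The footprint is monotone in the tuple. -/
lemma foot_mono {Y : Finset V} {t t' : Y → Set V} (h : t ≤ t') : foot t ⊆ foot t' := by
  rintro v ⟨y, hy⟩
  exact ⟨y, h y hy⟩

/-- On `{expl Y = t}` the footprint is closed under open adjacency. -/
lemma foot_closed {Y : Finset V} {t : Y → Set V} {ω : Config E} (hω : ω ∈ explEvent ends Y t)
    {a b : V} (ha : a ∈ foot t) (hab : (openGraph ends ω).Adj a b) : b ∈ foot t := by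
  obtain ⟨y, hy⟩ := ha
  refine ⟨y, ?_⟩
  rw [← hω y] at hy ⊢
  exact mem_cluster_of_adj hy hab

/-- **Restriction away from a closed set**: if `S` is closed under open adjacency, removing the
edges touching `S` does not change the connections of the vertices outside `S`
(the cell's `conn_restrict_iff_of_cluster_eq`, for any such `S`). -/
lemma conn_restrict_iff_of_closed {ω : Config E} {S : Set V}
    (hS : ∀ a ∈ S, ∀ b, (openGraph ends ω).Adj a b → b ∈ S) {u w : V} (hu : u ∉ S) :
    Conn ends (restrict (touches ends S)ᶜ ω) u w ↔ Conn ends ω u w := by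
  constructor
  · exact conn_mono (restrict_le _ ω)
  · intro h
    have key : w ∈ {x | x ∉ S ∧ Conn ends (restrict (touches ends S)ᶜ ω) u x} := by
      refine mem_of_conn_of_closed (ends := ends) (ω := ω) ?_ ⟨hu, conn_refl _ _ _⟩ h
      rintro x ⟨hxS, hxc⟩ y hxy
      obtain ⟨_, e, he, hends⟩ := openGraph_adj.1 hxy
      have hyS : y ∉ S := by
        intro hy
        apply hxS
        exact hS y hy x ((openGraph ends ω).adj_symm hxy)
      have hnt : e ∉ touches ends S := by
        rintro ⟨x', hx', y', hends'⟩
        rw [hends, Sym2.eq_iff] at hends'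
        rcases hends' with ⟨rfl, _⟩ | ⟨_, rfl⟩
        · exact hxS hx'
        · exact hyS hx'
      have he' : restrict (touches ends S)ᶜ ω e = true := restrict_eq_true_iff.2 ⟨he, hnt⟩
      exact ⟨hyS, conn_trans hxc (conn_of_openAdj ⟨e, he', hends⟩)⟩
    exact key.2

/-- On `{expl Y = t}`, a root `x ∉ foot t` is separated from every root of `Y`. -/
lemma mem_sepFam_of_explEvent {X Y : Finset V} {t : Y → Set V} {ω : Config E}
    (hω : ω ∈ explEvent ends Y t) (hX : ∀ x ∈ X, x ∉ foot t) : ω ∈ sepFam ends X Y := by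
  intro x hx y hy h
  apply hX x hx
  refine ⟨⟨y, hy⟩, ?_⟩
  rw [← hω ⟨y, hy⟩]
  exact conn_symm h

/-- On `{expl Y = t} ∩ S`, no root of `X` lies in the footprint. -/
lemma not_mem_foot_of_sepFam {X Y : Finset V} {t : Y → Set V} {ω : Config E}
    (hω : ω ∈ explEvent ends Y t) (hS : ω ∈ sepFam ends X Y) {x : V} (hx : x ∈ X) :
    x ∉ foot t := by
  rintro ⟨y, hy⟩
  apply hS x hx y y.2
  rw [← hω y] at hy
  exact conn_symm hy

/-- The joint event seen from the explored tuple of `Y` (no root of `X` in the footprint): the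
tuple of `X` is the tuple explored away from the footprint. -/
lemma jointFam_eq {X Y : Finset V} {t : Y → Set V} (hX : ∀ x ∈ X, x ∉ foot t) (k : X → Set V) :
    explEvent ends Y t ∩ explEvent ends X k ∩ sepFam ends X Y =
      explEvent ends Y t ∩ {ω | ∀ x : X, clAway ends (foot t) x ω = k x} := by
  ext ω
  simp only [Set.mem_inter_iff, mem_explEvent, Set.mem_setOf_eq, clAway]
  constructor
  · rintro ⟨⟨ht, hk⟩, -⟩
    refine ⟨ht, fun x => ?_⟩
    rw [← hk x]
    ext w
    simp only [mem_cluster]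
    exact conn_restrict_iff_of_closed (fun a ha b hab => foot_closed ht ha hab) (hX x x.2)
  · rintro ⟨ht, hk⟩
    refine ⟨⟨ht, fun x => ?_⟩, mem_sepFam_of_explEvent ht hX⟩
    rw [← hk x]
    ext w
    simp only [mem_cluster]
    exact (conn_restrict_iff_of_closed (fun a ha b hab => foot_closed ht ha hab) (hX x x.2)).symm

/-- `{expl Y = t}` is determined by the edges touching the footprint. -/
lemma dependsOn_explEvent (Y : Finset V) (t : Y → Set V) :
    DependsOn (· ∈ explEvent ends Y t) (touches ends (foot t)) := by
  intro ω ω' h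
  have hsub : ∀ y : Y, touches ends (t y) ⊆ touches ends (foot t) :=
    fun y => touches_mono ends (fun v hv => ⟨y, hv⟩)
  apply propext
  constructor
  · intro hω y
    exact cluster_eq_of_eqOn_touches (fun e he => h e (hsub y he)) (hω y)
  · intro hω y
    exact cluster_eq_of_eqOn_touches (fun e he => (h e (hsub y he)).symm) (hω y)

end FamilySets

section FamilyJoint

variable {V : Type*} {E : Type*} [Fintype V] [Fintype E] [DecidableEq E]
variable (ends : E → Sym2 V) (p : E → ℝ) (X Y : Finset V)

/-- The joint law of `(expl Y, expl X)` under `P(· | X ↮ Y)`. -/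
noncomputable def Jf (t : Y → Set V) (k : X → Set V) : ℝ :=
  prob p (explEvent ends Y t ∩ explEvent ends X k ∩ sepFam ends X Y) / prob p (sepFam ends X Y)

omit [Fintype V] in
/-- **Domain Markov for the family joint law** (no root of `X` in the footprint of `t`). -/
theorem prob_joint_fam {t : Y → Set V} (hX : ∀ x ∈ X, x ∉ foot t) (k : X → Set V) :
    prob p (explEvent ends Y t ∩ explEvent ends X k ∩ sepFam ends X Y) =
      prob p (explEvent ends Y t) *
        prob p {ω | ∀ x : X, clAway ends (foot t) x ω = k x} := by
  rw [jointFam_eq hX k]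
  exact prob_inter_eq_mul_of_dependsOn p disjoint_compl_right (dependsOn_explEvent Y t)
    (dependsOn_restrict (touches ends (foot t))ᶜ fun ω' => ∀ x : X, cluster ends ω' x = k x)

omit [Fintype V] in
/-- **Domain Markov for the family joint law**, from the `X` side. -/
theorem prob_joint_fam' {k : X → Set V} (hY : ∀ y ∈ Y, y ∉ foot k) (t : Y → Set V) :
    prob p (explEvent ends Y t ∩ explEvent ends X k ∩ sepFam ends X Y) =
      prob p (explEvent ends X k) *
        prob p {ω | ∀ y : Y, clAway ends (foot k) y ω = t y} := by
  have hswap : explEvent ends Y t ∩ explEvent ends X k ∩ sepFam ends X Y =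
      explEvent ends X k ∩ explEvent ends Y t ∩ sepFam ends Y X := by
    ext ω
    simp only [Set.mem_inter_iff, sepFam, Set.mem_setOf_eq]
    constructor
    · rintro ⟨⟨ht, hk⟩, hS⟩
      exact ⟨⟨hk, ht⟩, fun y hy x hx h => hS x hx y hy (conn_symm h)⟩
    · rintro ⟨⟨hk, ht⟩, hS⟩
      exact ⟨⟨ht, hk⟩, fun x hx y hy h => hS y hy x hx (conn_symm h)⟩
  rw [hswap, jointFam_eq hY t]
  exact prob_inter_eq_mul_of_dependsOn p disjoint_compl_right (dependsOn_explEvent X k)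
    (dependsOn_restrict (touches ends (foot k))ᶜ fun ω' => ∀ y : Y, cluster ends ω' y = t y)

/-- The `Y`-marginal of the family joint law. -/
theorem sum_Jf_right (t : Y → Set V) :
    ∑ k, Jf ends p X Y t k =
      prob p (explEvent ends Y t ∩ sepFam ends X Y) / prob p (sepFam ends X Y) := by
  unfold Jf
  rw [← Finset.sum_div]
  congr 1
  rw [prob_eq_sum_prob_inter p (explEvent ends Y t ∩ sepFam ends X Y) (fun ω => expl ends ω X)]
  apply Finset.sum_congr rfl
  intro k _
  congr 1
  rw [← explEvent_eq_preimage]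
  ext ω
  simp only [Set.mem_inter_iff]
  tauto

/-- The `X`-marginal of the family joint law. -/
theorem sum_Jf_left (k : X → Set V) :
    ∑ t, Jf ends p X Y t k =
      prob p (explEvent ends X k ∩ sepFam ends X Y) / prob p (sepFam ends X Y) := by
  unfold Jf
  rw [← Finset.sum_div]
  congr 1
  rw [prob_eq_sum_prob_inter p (explEvent ends X k ∩ sepFam ends X Y) (fun ω => expl ends ω Y)]
  apply Finset.sum_congr rfl
  intro t _
  congr 1
  rw [← explEvent_eq_preimage]
  ext ω
  simp only [Set.mem_inter_iff]
  tauto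

end FamilyJoint

end SepPA

end Summit.Ventures.PercRepro2
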